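import Summits.QuantumFields.BalabanUV.T4Continuum.Support.NE4TwoRunChannels

/-!
# NE4TwoRunChannelsWeighted — binder row NE4 (spine node U2), technique P2 «two-trajectory comparison at spacings ε vs ε/L»,
# ROUND-2 SKELETON `HOME/t4/skeletons/NE4-t4-ne4-p2.md`: the AGE-WEIGHTED birth channel — the placement of the fading factor
# that [Balaban1988RG2Cluster] §1 PRINTS for one run at the activity level — and node U2's spine output from it, BY TYPE
# (cell `pub-balaban`, T⁴-continuum fan-out, `HOME/BINDER-OWNERS.md` row NE4, co-owner seat t4-ne4-p2, gen 18)

HONEST FRAMING (T4-DAG PAGE 1).  Rung (B)+1 on a FIXED finite torus T⁴ — NOT infinite volume, NOT a mass gap, NOT the Clay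
problem.  NE4 is NOT PRINTED and NOT PROVED; this module, like its parent `NE4TwoRunChannels` (p206710), ASSERTS NOTHING about
Bałaban's effective actions: `BirthChannelsW` is a HYPOTHESIS SHAPE over real sequences, consumed as a binder; the theorems are
elementary real arithmetic.  CONDITIONALS BY NAME: (AF-0r) = binder `hconv` (β sub-cell, BetaPertH member, NOT discharged);
runs/box/pin = binders (node U1/H3); the read-out estimate `T4TwoRunMatching.TwoRunReadOut` = binder `hread`.  HONEST
DEPENDENCY (cell, verbatim): continuum YM on T⁴ ⇐ BetaPertH ∧ nine spine estimates (0/9 proved); BetaPertH ⇐ (D1) ∧ (D4) ∧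
CAP+tail; G-an2-4 gates asym, D1 and NE2/3/4.  VALUE = kernel bookkeeping of the skeleton's leaf cut; NOT summit progress.

WHAT PRINT SAYS (render `b2b-balaban-ref1/pages/1988-cmp116-rg-II-cluster/…-p007-x2.png` read as an image by this seat;
p. 8 as quoted in the cell cross-read C-b12g8-1, record `t4/T4-XREAD-U2R2.md`).  [Balaban1988RG2Cluster] = cell paper B13 =
[II], §1, the contribution of an OLD scale-j term E^{(j)}(X, ·) of (I.1.18)-size E₀ to the step-k fluctuation-field action,
after the Cauchy representation (1.23) in t_□ and σ(Δ): (1.24) p. 7 «|(1.23)| ≤ 8B₀C₁e^{16κ₁}α₂⁻¹ g_k|B| E₀ (α₁/α₃)⁵ (L^jη)⁵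
· exp(−(κ₁ − 1)M⁻⁴|Y₀∖□̃⁴|) exp(−κd_j(X))»; p. 8 «This yields (6L)⁴L^jη, and the sum over j is bounded by 2(6L)⁴»; p. 9
Lemma 1 (1.33)–(1.36): the curly bracket of (I.2.12) equals Σ_Y V_k(Y, U_{k+1}, B) with localized, analytic, bounded V_k.
READING (C-b12g8-1, certified by inspection): the old-term channel is LINEAR in the family {E^{(j)}}_{j≤k}, its printed
bound carries the coupling factor g_k|B| and, per old scale j, the NET AGE FACTOR L^jη = L^{−(k−j)}, while the old term
enters with its BIRTH-SCALE size E₀ — print puts the fading factor INTO THE BIRTH CHANNEL and re-evaluates old terms at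
rate one.  NOT PRINTED (cell GAPS G-b12g8-1): the activity → value Lipschitz step through [II] §2's exponentiated cluster
expansion (printed TYPE: one Cauchy estimate in an interpolation parameter ζ run through (2.15)–(2.41)); and any two-run
statement.

THE MODELLING POINT.  `BirthChannelsW K ℓ′ μ ϖ` = `NE4TwoRunChannels.BirthChannels` with the age weight `ϖ^{j−1−i}` inside the
memory sum (ϖ = L⁻¹ in the reading above; `BirthChannels` is the case ϖ = 1, `birthChannelsW_one_iff`).  With the transport
law of the parent module at ANY rate `ω` (rate one = re-evaluation of an old term on nested regular spaces does not
increase a sup-norm; the transport source τ carries the η-rate of the one-level minimizer maps, row NE3), the kernel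
conclusion of the parent holds at the COMBINED fading rate `ϖ·ω`: `TwoRunRenewal a ℓ′ ρ M` with `M j i = μ·p₀·(ϖω)^{j−1−i}`,
`FadingMemory (μp₀/(ϖω)) (ϖω) M`, gap `ϖω + μ·p₀ < ρ`, and node U2's spine binder `T4CauchySum.InjectedRate … 0 ρ (fun K j ↦
disc (g K) (g (K+1)) j)` BY TYPE (`injectedRate_of_channelsW` = `T4TwoRunMatching.injectedRate_of_twoRun_runs` ∘ §1).

NEW module of unit `b2b-balaban-t4-ne4-p2` (gen 18); imports `NE4TwoRunChannels` only (hence `T4TwoRunMatching` …);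
modifies nothing; no `sorry`, no `axiom`.
-/

namespace Summit.QuantumFields.BalabanUV.T4Continuum.NE4TwoRunChannelsWeighted

open Literature.MathematicalPhysics.QuantumFieldTheory.Balaban1983to89
open FlowStep (HBeta RGEqH)
open T4CouplingMatching (disc FadingMemory)
open T4TwoRunMatching (TwoRunRenewal TwoRunReadOut)
open Summit.QuantumFields.BalabanUV.T4Continuum.NE4TwoRunChannels
open Finset

/-! ## §1 The AGE-WEIGHTED birth channel — the printed placement of the fading factor

[Balaban1988RG2Cluster] §1 bounds the contribution of an OLD scale-`i` term to the step-`k` fluctuation-field action by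
(1.24) p. 7 «|(1.23)| ≤ 8B₀C₁e^{16κ₁}α₂⁻¹ g_k|B| E₀ (α₁/α₃)⁵ (L^jη)⁵ · exp(−(κ₁ − 1)M⁻⁴|Y₀∖□̃⁴|) exp(−κd_j(X))» and p. 8 «This
yields (6L)⁴L^jη, and the sum over j is bounded by 2(6L)⁴» (render `…/1988-cmp116-rg-II-cluster-p007-x2.png` read as an image
by this seat; p. 8 as certified in the cell cross-read C-b12g8-1): the old-term channel is LINEAR in the old terms (C-b12g8-1),
carries the coupling factor g_k|B| and a NET AGE FACTOR L^jη = L^{−(k−j)} per old scale, while the old term itself enters with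
its birth-scale size E₀ of (I.1.18) — i.e. print puts the fading factor INTO THE BIRTH CHANNEL and re-evaluates old terms at
rate one.  The shape below records exactly that placement (weight `ϖ^{j−1−i}` inside the memory sum); the parent's `TransportLaw` may
then be used at any rate `ω ≤ 1` (rate 1 = re-evaluation on nested regular spaces does not increase a sup-norm), and the
kernel conclusion is the v1 one with the COMBINED fading rate `ϖ·ω`.  Nothing of [II] is asserted: the activity → value
step through [II] §2 (cell GAPS G-b12g8-1) and the two-run (Duhamel) framing remain hypotheses of the skeleton. -/

/-- HYPOTHESIS SHAPE `BirthChannelsW` (NOT PRINTED as a two-run statement; asserted nowhere): the parent's birth channels with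
an explicit AGE WEIGHT `ϖ^{j−1−i}` on the transported older pair discrepancies inside the memory sum — the placement of the
fading factor printed for ONE run at the activity level in [Balaban1988RG2Cluster] (1.24) p. 7 / p. 8 (net factor L^jη per
old scale, coupling factor g_k|B| in front).  `BirthChannels` is the case `ϖ = 1`. [folklore] -/
def BirthChannelsW (K : ℕ) (ℓ' μ ϖ : ℝ) (gA gB : ℕ → ℝ) (b σ u : ℕ → ℝ) (e : ℕ → ℕ → ℝ) : Prop :=
  ∀ j, j < K → b j ≤ σ j + ℓ' * |gA j - gB (j + 1)|
    + μ * ((∑ i ∈ range j, ϖ ^ (j - 1 - i) * e i (j - 1 - i)) + u j)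

/-- `BirthChannels` is `BirthChannelsW` with age weight `ϖ = 1`. [folklore] -/
theorem birthChannelsW_one_iff {K : ℕ} {ℓ' μ : ℝ} {gA gB b σ u : ℕ → ℝ} {e : ℕ → ℕ → ℝ} :
    BirthChannelsW K ℓ' μ 1 gA gB b σ u e ↔ BirthChannels K ℓ' μ gA gB b σ u e := by
  simp [BirthChannelsW, BirthChannels]

/-- **THE LEAF CUT WITH THE PRINTED PLACEMENT OF THE AGE FACTOR.**  Age-weighted birth channels (`BirthChannelsW K ℓ′ μ ϖ`,
`0 ≤ ϖ`), birth-level projection, the transport law at ANY rate `ω` with `0 ≤ ν < ω` (rate `ω = 1` allowed) and geometric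
sources give `T4TwoRunMatching.TwoRunRenewal a ℓ′ ρ M gA gB b K` with `M j i = μ·p₀·(ϖω)^{j−1−i}` and
`a = a₁ + μ·aU + μ·(aZ + aτ/(ω − ν))/(ρ − ϖω)`, provided the COMBINED fading rate satisfies `ϖ·ω < ρ`.  Bookkeeping only.
[folklore] -/
theorem twoRunRenewal_of_channelsW {K : ℕ} {ℓ' μ ϖ p₀ ω ν ρ a₁ aU aZ aτ : ℝ} {gA gB b σ u z : ℕ → ℝ}
    {e τ : ℕ → ℕ → ℝ}
    (hμ : 0 ≤ μ) (hϖ : 0 ≤ ϖ) (hω : 0 ≤ ω) (hν : 0 ≤ ν) (hνω : ν < ω) (hϖωρ : ϖ * ω < ρ)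
    (haZ : 0 ≤ aZ) (haτ : 0 ≤ aτ)
    (hbirth : BirthChannelsW K ℓ' μ ϖ gA gB b σ u e) (hproj : BirthProjection K p₀ b z e)
    (htr : TransportLaw K ω e τ)
    (hσ : ∀ j, σ j ≤ a₁ * ρ ^ j) (hu : ∀ j, u j ≤ aU * ρ ^ j) (hz : ∀ i, z i ≤ aZ * ρ ^ i)
    (hτ : ∀ i n, τ i n ≤ aτ * ρ ^ i * ν ^ n) :
    TwoRunRenewal (a₁ + μ * aU + μ * (aZ + aτ / (ω - ν)) / (ρ - ϖ * ω)) ℓ' ρ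
      (fun j i => μ * p₀ * (ϖ * ω) ^ (j - 1 - i)) gA gB b K := by
  have hϖω : 0 ≤ ϖ * ω := mul_nonneg hϖ hω
  have hρ : 0 ≤ ρ := hϖω.trans hϖωρ.le
  have hden : 0 < ω - ν := sub_pos.mpr hνω
  have hden' : 0 < ρ - ϖ * ω := sub_pos.mpr hϖωρ
  intro j hj
  have hei : ∀ i ∈ range j,
      ϖ ^ (j - 1 - i) * e i (j - 1 - i)
        ≤ (ϖ * ω) ^ (j - 1 - i) * (p₀ * b i) + (aZ + aτ / (ω - ν)) * ((ϖ * ω) ^ (j - 1 - i) * ρ ^ i) := by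
    intro i hi
    have hij : i < j := mem_range.mp hi
    have h1 := transport_unrolled hω hν hνω haτ hρ htr hτ i (j - 1 - i) (by omega)
    have h2 := hproj i (by omega)
    have h3 := hz i
    have hωn : 0 ≤ ω ^ (j - 1 - i) := pow_nonneg hω _
    have hϖn : 0 ≤ ϖ ^ (j - 1 - i) := pow_nonneg hϖ _
    have h4 : ω ^ (j - 1 - i) * e i 0 ≤ ω ^ (j - 1 - i) * (p₀ * b i + aZ * ρ ^ i) :=
      mul_le_mul_of_nonneg_left (h2.trans (by linarith)) hωn
    have h5 : e i (j - 1 - i) ≤ ω ^ (j - 1 - i) * (p₀ * b i + aZ * ρ ^ i) + aτ * ρ ^ i * (ω ^ (j - 1 - i) / (ω - ν)) := by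
      linarith
    have h6 := mul_le_mul_of_nonneg_left h5 hϖn
    have e7 : ϖ ^ (j - 1 - i) * (ω ^ (j - 1 - i) * (p₀ * b i + aZ * ρ ^ i) + aτ * ρ ^ i * (ω ^ (j - 1 - i) / (ω - ν)))
        = (ϖ * ω) ^ (j - 1 - i) * (p₀ * b i) + (aZ + aτ / (ω - ν)) * ((ϖ * ω) ^ (j - 1 - i) * ρ ^ i) := by
      rw [mul_pow]
      field_simp
      ring
    linarith
  have hsum : ∑ i ∈ range j, ϖ ^ (j - 1 - i) * e i (j - 1 - i)
      ≤ ∑ i ∈ range j, ((ϖ * ω) ^ (j - 1 - i) * (p₀ * b i)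
          + (aZ + aτ / (ω - ν)) * ((ϖ * ω) ^ (j - 1 - i) * ρ ^ i)) :=
    Finset.sum_le_sum hei
  rw [Finset.sum_add_distrib, ← Finset.mul_sum] at hsum
  have hgeo := sum_pow_mul_pow_le hϖω hϖωρ j
  have hcoef : 0 ≤ aZ + aτ / (ω - ν) := add_nonneg haZ (div_nonneg haτ hden.le)
  have h6 : (aZ + aτ / (ω - ν)) * ∑ i ∈ range j, (ϖ * ω) ^ (j - 1 - i) * ρ ^ i
      ≤ (aZ + aτ / (ω - ν)) * (ρ ^ j / (ρ - ϖ * ω)) := mul_le_mul_of_nonneg_left hgeo hcoef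
  have h7 := hbirth j hj
  have h8 := hσ j
  have h9 := hu j
  have h10 : μ * ((∑ i ∈ range j, ϖ ^ (j - 1 - i) * e i (j - 1 - i)) + u j)
      ≤ μ * ((∑ i ∈ range j, (ϖ * ω) ^ (j - 1 - i) * (p₀ * b i)) + (aZ + aτ / (ω - ν)) * (ρ ^ j / (ρ - ϖ * ω))
          + aU * ρ ^ j) :=
    mul_le_mul_of_nonneg_left (by linarith) hμ
  have e11 : ∑ i ∈ range j, μ * p₀ * (ϖ * ω) ^ (j - 1 - i) * b i
      = μ * ∑ i ∈ range j, (ϖ * ω) ^ (j - 1 - i) * (p₀ * b i) := by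
    rw [Finset.mul_sum]
    exact Finset.sum_congr rfl fun i _ => by ring
  rw [e11]
  have e12 : (a₁ + μ * aU + μ * (aZ + aτ / (ω - ν)) / (ρ - ϖ * ω)) * ρ ^ j
      = a₁ * ρ ^ j + μ * ((aZ + aτ / (ω - ν)) * (ρ ^ j / (ρ - ϖ * ω)) + aU * ρ ^ j) := by
    field_simp
    ring
  rw [e12]
  nlinarith [h7, h8, h9, h10]

/-- With the printed placement the channel memory kernel `M j i = μ·p₀·(ϖω)^{j−1−i}` is a `FadingMemory (μp₀/(ϖω)) (ϖω)` for
`0 < ϖω ≤ 1` — the v1 lemma at the combined rate; the node-U2 gap reads `ϖω + μ·p₀ < ρ` (`gap_iff` at `ϖω`). [folklore] -/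
theorem fadingMemory_of_channelsW {μ p₀ ϖ ω : ℝ} (hμ : 0 ≤ μ) (hp₀ : 0 ≤ p₀) (h0 : 0 < ϖ * ω) (h1 : ϖ * ω ≤ 1) :
    FadingMemory (μ * p₀ / (ϖ * ω)) (ϖ * ω) (fun j i => μ * p₀ * (ϖ * ω) ^ (j - 1 - i)) :=
  fadingMemory_of_channels hμ hp₀ h0 h1

/-- **NODE U2's SPINE OUTPUT FROM THE AGE-WEIGHTED CHANNELS (printed placement of the fading factor), K-UNIFORM.**  As
`injectedRate_of_channels`, with `BirthChannelsW … ϖ` (age weight in the birth channel, [II] (1.24)/p. 8) and the transport law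
at any rate `ω` (`0 ≤ ν < ω`, `0 < ϖω ≤ 1`); gap `ϖω + μ·p₀ < ρ < 1`; conclusion = the spine binder `hinj` BY TYPE with
`θc := ρ`.  `T4TwoRunMatching.injectedRate_of_twoRun_runs` ∘ `twoRunRenewal_of_channelsW`.  Bookkeeping over UNPRINTED inputs;
NOT summit progress. [folklore] -/
theorem injectedRate_of_channelsW {β : HBeta} (S : B12Beta.OneLoopSplit β) (g : ℕ → ℕ → ℝ) (gIR : ℝ)
    {b σ u z : ℕ → ℕ → ℝ} {e τ : ℕ → ℕ → ℕ → ℝ}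
    {γ binf c₀ r ℓ' μ ϖ p₀ ω ν ρ a₁ aU aZ aτ : ℝ}
    (hρ1 : ρ < 1) (hϖ : 0 ≤ ϖ) (hω : 0 ≤ ω) (h0 : 0 < ϖ * ω) (h1 : ϖ * ω ≤ 1) (hν : 0 ≤ ν) (hνω : ν < ω)
    (hgap : ϖ * ω + μ * p₀ < ρ)
    (hc₀ : 0 ≤ c₀) (hr : 0 ≤ r) (hℓ' : 0 ≤ ℓ') (hμ : 0 ≤ μ) (hp₀ : 0 ≤ p₀)
    (ha₁ : 0 ≤ a₁) (haU : 0 ≤ aU) (haZ : 0 ≤ aZ) (haτ : 0 ≤ aτ)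
    (hrun : ∀ K, RGEqH K β (g K)) (hbox : ∀ K i, i ≤ K → 0 < g K i ∧ g K i ≤ γ) (hpin : ∀ K, g K K = gIR)
    (hconv : ∀ k, |S.β0 k - binf| ≤ c₀ * ρ ^ k)
    (hread : ∀ K, TwoRunReadOut S r (g K) (g (K + 1)) (b K) K)
    (hb0 : ∀ K i, i < K → 0 ≤ b K i)
    (hbirth : ∀ K, BirthChannelsW K ℓ' μ ϖ (g K) (g (K + 1)) (b K) (σ K) (u K) (e K))
    (hproj : ∀ K, BirthProjection K p₀ (b K) (z K) (e K))
    (htr : ∀ K, TransportLaw K ω (e K) (τ K))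
    (hσ : ∀ K j, σ K j ≤ a₁ * ρ ^ j) (hu : ∀ K j, u K j ≤ aU * ρ ^ j) (hz : ∀ K i, z K i ≤ aZ * ρ ^ i)
    (hτ : ∀ K i n, τ K i n ≤ aτ * ρ ^ i * ν ^ n)
    (hgain : r * (ℓ' * γ ^ 3) * ((ρ - ϖ * ω) / (ρ - (1 + μ * p₀ / (ϖ * ω)) * (ϖ * ω))) ≤ (1 - ρ) / 2) :
    T4CauchySum.InjectedRate
      (2 * (2 * c₀ + r * (a₁ + μ * aU + μ * (aZ + aτ / (ω - ν)) / (ρ - ϖ * ω))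
        * ((ρ - ϖ * ω) / (ρ - (1 + μ * p₀ / (ϖ * ω)) * (ϖ * ω)))) / (1 - ρ)) 0 ρ
      (fun K j => disc (g K) (g (K + 1)) j) := by
  have hϖωρ : ϖ * ω < ρ := by nlinarith [mul_nonneg hμ hp₀]
  have hsmall : (1 + μ * p₀ / (ϖ * ω)) * (ϖ * ω) < ρ := (gap_iff h0).mpr hgap
  have hC : 0 ≤ μ * p₀ / (ϖ * ω) := div_nonneg (mul_nonneg hμ hp₀) h0.le
  have ha : 0 ≤ a₁ + μ * aU + μ * (aZ + aτ / (ω - ν)) / (ρ - ϖ * ω) := by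
    have h1' : 0 ≤ aτ / (ω - ν) := div_nonneg haτ (sub_pos.mpr hνω).le
    have h2 : 0 ≤ μ * (aZ + aτ / (ω - ν)) / (ρ - ϖ * ω) :=
      div_nonneg (mul_nonneg hμ (add_nonneg haZ h1')) (sub_pos.mpr hϖωρ).le
    positivity
  exact T4TwoRunMatching.injectedRate_of_twoRun_runs S g gIR hρ1 h0.le hC hsmall hc₀ ha hℓ' hr hrun hbox hpin
    hconv hread
    (fun K => twoRunRenewal_of_channelsW hμ hϖ hω hν hνω hϖωρ haZ haτ (hbirth K) (hproj K) (htr K)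
      (hσ K) (hu K) (hz K) (hτ K))
    hb0 (fun _ => fadingMemory_of_channelsW hμ hp₀ h0 h1) hgain

end Summit.QuantumFields.BalabanUV.T4Continuum.NE4TwoRunChannelsWeighted
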